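import Summits.Parity.GeneralizedHardyLittlewood.Theorems.PrimeLevelFamEdgeMomentsBeyondDiagonalDiagRemMonomials
import HarnessLib

/-!
# Route `PrimeLevelFamEdge`, crux K_A `MomentsBeyondDiagonal` (stmt-Parity-20007), line «petersson_layers» v4, stub `stub_diag`:
# **powers of `L = 2β + ℓ⁺(k₁) + ℓ⁺(k₂)` against a remainder kernel** (brick B3a of the remainder estimate (R₂₂))

First half of brick B3 (monomial bookkeeping) of the order-`(2,2)` remainder estimate (R₂₂) — the hypothesis `hR₂₂` of
`…DiagRungTwoOfR22.diagPart_asymp_of_natDegree_le_two_of_remainder` (p830190). The order-`(2,2)` remainder weight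
(`…DiagDecorOrderRungTwoHecke.heckeSum_orderTwoTwo_eq`) carries powers `L^p`, `p ≤ 4`, of `L = 2β + ℓ⁺(k₁) + ℓ⁺(k₂)`;
instead of expanding them (≈ 95 monomials) we bound `L^p` against any kernel by induction on `p` from the `p = 0` monomial
bounds — the generic replacement of the fifteen `coef_term_le` applications of the order-`(1,1)` file `…DiagRemMonomials`.

* `abs_Lpow_monomial_le` — `|Σ a₁a₂ℓ⁺₁^{m₁}ℓ⁺₂^{m₂}L^p R(αk₁k₂)| ≤ (4Λ)^p·log^{m₁+m₂}Y·Ψ` from the `p = 0` bounds (all `i,j ≥ 1`);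
* `sum_swap_decor_Lpow` — moving a row decoration to the column by `k₁ ↔ k₂` (`L`, `αk₁k₂` symmetric).

Def-free; theorems only. Helper `--supports stmt-Parity-20007`; closes nothing; K_A, K_B and the Parity summit are NOT
proved; nothing about Landau–Siegel zeros.

## References
* E. Kowalski, P. Michel, J. VanderKam, J. reine angew. Math. 526 (2000), (22)–(28) pp. 12–15 and Prop. 5.1 p. 18.
  [cite: KowalskiMichelVanderKam2000, (23)–(28) — derivation (order-(2,2) remainder weight, monomial bookkeeping)]
-/

noncomputable section

open Finset Real Polynomial

namespace Summit.Parity.GeneralizedHardyLittlewood.Theorems.MomentsBeyondDiagonal.DiagCorner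

open Summit.Parity.GeneralizedHardyLittlewood.Theorems.BeyondDiagonalBeatsQuarter.Corner

/-- **Powers of `L = 2β + ℓ⁺(k₁) + ℓ⁺(k₂)` against a remainder kernel.** If every monomial sum
`Σ a₁(k₁)a₂(k₂)ℓ⁺(k₁)ⁱℓ⁺(k₂)ʲR(αk₁k₂)` (`i, j ≥ 1`) is `≤ logⁱ⁺ʲY·Ψ`, then for every `p` and `m₁, m₂ ≥ 1`
`|Σ a₁(k₁)a₂(k₂)ℓ⁺(k₁)^{m₁}ℓ⁺(k₂)^{m₂}·L^p·R(αk₁k₂)| ≤ (4Λ)^p·log^{m₁+m₂}Y·Ψ` (`|β|, log Y ≤ Λ`, `1 ≤ Λ`, `Y ≥ 1`).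
[folklore] -/
theorem abs_Lpow_monomial_le {a₁ a₂ : ℕ → ℝ} {R : ℝ → ℝ} {Y α β Λ Ψ : ℝ}
    (hY : 1 ≤ Y) (hΛ : 1 ≤ Λ) (hβ : |β| ≤ Λ) (hLY : Real.log Y ≤ Λ) (hΨ : 0 ≤ Ψ)
    (h : ∀ i j : ℕ, 1 ≤ i → 1 ≤ j →
      |∑ k₁ ∈ Icc 1 ⌊Y⌋₊, ∑ k₂ ∈ Icc 1 ⌊Y⌋₊,
          a₁ k₁ * a₂ k₂ * ellp Y k₁ ^ i * ellp Y k₂ ^ j * R (α * k₁ * k₂)| ≤ Real.log Y ^ (i + j) * Ψ) :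
    ∀ p m₁ m₂ : ℕ, 1 ≤ m₁ → 1 ≤ m₂ →
      |∑ k₁ ∈ Icc 1 ⌊Y⌋₊, ∑ k₂ ∈ Icc 1 ⌊Y⌋₊,
          a₁ k₁ * a₂ k₂ * ellp Y k₁ ^ m₁ * ellp Y k₂ ^ m₂ *
            ((2 * β + ellp Y k₁ + ellp Y k₂) ^ p * R (α * k₁ * k₂))| ≤
        (4 * Λ) ^ p * (Real.log Y ^ (m₁ + m₂) * Ψ) := by
  have hL0 : 0 ≤ Real.log Y := Real.log_nonneg hY
  have hΛ0 : 0 ≤ Λ := zero_le_one.trans hΛ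
  intro p
  induction p with
  | zero =>
    intro m₁ m₂ hm₁ hm₂
    simp only [pow_zero, one_mul]
    exact h m₁ m₂ hm₁ hm₂
  | succ p ih =>
    intro m₁ m₂ hm₁ hm₂
    set I := Icc 1 ⌊Y⌋₊ with hI
    have e : ∑ k₁ ∈ I, ∑ k₂ ∈ I, a₁ k₁ * a₂ k₂ * ellp Y k₁ ^ m₁ * ellp Y k₂ ^ m₂ *
          ((2 * β + ellp Y k₁ + ellp Y k₂) ^ (p + 1) * R (α * k₁ * k₂)) =
        2 * β * ∑ k₁ ∈ I, ∑ k₂ ∈ I, a₁ k₁ * a₂ k₂ * ellp Y k₁ ^ m₁ * ellp Y k₂ ^ m₂ *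
          ((2 * β + ellp Y k₁ + ellp Y k₂) ^ p * R (α * k₁ * k₂)) +
        ∑ k₁ ∈ I, ∑ k₂ ∈ I, a₁ k₁ * a₂ k₂ * ellp Y k₁ ^ (m₁ + 1) * ellp Y k₂ ^ m₂ *
          ((2 * β + ellp Y k₁ + ellp Y k₂) ^ p * R (α * k₁ * k₂)) +
        ∑ k₁ ∈ I, ∑ k₂ ∈ I, a₁ k₁ * a₂ k₂ * ellp Y k₁ ^ m₁ * ellp Y k₂ ^ (m₂ + 1) *
          ((2 * β + ellp Y k₁ + ellp Y k₂) ^ p * R (α * k₁ * k₂)) := by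
      rw [Finset.mul_sum, ← Finset.sum_add_distrib, ← Finset.sum_add_distrib]
      refine Finset.sum_congr rfl fun k₁ _ ↦ ?_
      rw [Finset.mul_sum, ← Finset.sum_add_distrib, ← Finset.sum_add_distrib]
      refine Finset.sum_congr rfl fun k₂ _ ↦ ?_
      ring
    rw [e]
    have g1 := ih m₁ m₂ hm₁ hm₂
    have g2 := ih (m₁ + 1) m₂ (by omega) hm₂
    have g3 := ih m₁ (m₂ + 1) hm₁ (by omega)
    rw [show Real.log Y ^ (m₁ + 1 + m₂) = Real.log Y ^ (m₁ + m₂) * Real.log Y by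
      rw [show m₁ + 1 + m₂ = (m₁ + m₂) + 1 by ring, pow_succ]] at g2
    rw [show Real.log Y ^ (m₁ + (m₂ + 1)) = Real.log Y ^ (m₁ + m₂) * Real.log Y by
      rw [show m₁ + (m₂ + 1) = (m₁ + m₂) + 1 by ring, pow_succ]] at g3
    set X : ℝ := (4 * Λ) ^ p * (Real.log Y ^ (m₁ + m₂) * Ψ) with hX
    have hX0 : 0 ≤ X := by positivity
    have hre : (4 * Λ) ^ p * (Real.log Y ^ (m₁ + m₂) * Real.log Y * Ψ) = Real.log Y * X := by
      rw [hX]; ring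
    rw [hre] at g2 g3
    have g2' : |∑ k₁ ∈ I, ∑ k₂ ∈ I, a₁ k₁ * a₂ k₂ * ellp Y k₁ ^ (m₁ + 1) * ellp Y k₂ ^ m₂ *
        ((2 * β + ellp Y k₁ + ellp Y k₂) ^ p * R (α * k₁ * k₂))| ≤ Λ * X :=
      g2.trans (mul_le_mul_of_nonneg_right hLY hX0)
    have g3' : |∑ k₁ ∈ I, ∑ k₂ ∈ I, a₁ k₁ * a₂ k₂ * ellp Y k₁ ^ m₁ * ellp Y k₂ ^ (m₂ + 1) *
        ((2 * β + ellp Y k₁ + ellp Y k₂) ^ p * R (α * k₁ * k₂))| ≤ Λ * X :=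
      g3.trans (mul_le_mul_of_nonneg_right hLY hX0)
    have g1' : |2 * β * ∑ k₁ ∈ I, ∑ k₂ ∈ I, a₁ k₁ * a₂ k₂ * ellp Y k₁ ^ m₁ * ellp Y k₂ ^ m₂ *
        ((2 * β + ellp Y k₁ + ellp Y k₂) ^ p * R (α * k₁ * k₂))| ≤ 2 * Λ * X := by
      rw [abs_mul, abs_mul, abs_two]
      exact mul_le_mul (mul_le_mul_of_nonneg_left hβ zero_le_two) g1 (abs_nonneg _) (by positivity)
    calc _ ≤ |2 * β * ∑ k₁ ∈ I, ∑ k₂ ∈ I, a₁ k₁ * a₂ k₂ * ellp Y k₁ ^ m₁ * ellp Y k₂ ^ m₂ *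
            ((2 * β + ellp Y k₁ + ellp Y k₂) ^ p * R (α * k₁ * k₂))| +
          |∑ k₁ ∈ I, ∑ k₂ ∈ I, a₁ k₁ * a₂ k₂ * ellp Y k₁ ^ (m₁ + 1) * ellp Y k₂ ^ m₂ *
            ((2 * β + ellp Y k₁ + ellp Y k₂) ^ p * R (α * k₁ * k₂))| +
          |∑ k₁ ∈ I, ∑ k₂ ∈ I, a₁ k₁ * a₂ k₂ * ellp Y k₁ ^ m₁ * ellp Y k₂ ^ (m₂ + 1) *
            ((2 * β + ellp Y k₁ + ellp Y k₂) ^ p * R (α * k₁ * k₂))| := abs_add_three _ _ _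
      _ ≤ 2 * Λ * X + Λ * X + Λ * X := add_le_add (add_le_add g1' g2') g3'
      _ = (4 * Λ) ^ (p + 1) * (Real.log Y ^ (m₁ + m₂) * Ψ) := by rw [hX, pow_succ]; ring

/-- Moving a row decoration `D(k₁)` to the column by the swap `k₁ ↔ k₂` (`L` and `αk₁k₂` are symmetric). [folklore] -/
theorem sum_swap_decor_Lpow (a D : ℕ → ℝ) (R : ℝ → ℝ) (Y α β : ℝ) (m₁ m₂ p : ℕ) (I : Finset ℕ) :
    ∑ k₁ ∈ I, ∑ k₂ ∈ I, a k₁ * D k₁ * a k₂ * ellp Y k₁ ^ m₁ * ellp Y k₂ ^ m₂ *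
        ((2 * β + ellp Y k₁ + ellp Y k₂) ^ p * R (α * k₁ * k₂)) =
      ∑ k₁ ∈ I, ∑ k₂ ∈ I, a k₁ * (a k₂ * D k₂) * ellp Y k₁ ^ m₂ * ellp Y k₂ ^ m₁ *
        ((2 * β + ellp Y k₁ + ellp Y k₂) ^ p * R (α * k₁ * k₂)) := by
  rw [Finset.sum_comm]
  refine Finset.sum_congr rfl fun k₁ _ ↦ Finset.sum_congr rfl fun k₂ _ ↦ ?_
  rw [show α * (k₂ : ℝ) * k₁ = α * k₁ * k₂ by ring,
    show 2 * β + ellp Y k₂ + ellp Y k₁ = 2 * β + ellp Y k₁ + ellp Y k₂ by ring]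
  ring

end Summit.Parity.GeneralizedHardyLittlewood.Theorems.MomentsBeyondDiagonal.DiagCorner

end
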